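import Summits.HodgeConjecture.HodgeConjecture.Theorems.Ring2AbelianAllAndrePrimitiveLift
import Summits.HodgeConjecture.HodgeConjecture.Theorems.Ring2AbelianAllAndreInvariantHodgeTypes
import Literature.AlgebraicGeometry.HodgeTheory.HodgeRiemannPolarizabilityProofs
import Literature.AlgebraicGeometry.HodgeTheory.ComplexGysinHodgeType
import Literature.AlgebraicGeometry.HodgeTheory.ComplexOrientationCycleClassFacts
import Literature.AlgebraicGeometry.HodgeTheory.HodgeTypeConjugation
import Literature.AlgebraicGeometry.HodgeTheory.HodgeTypeExteriorProduct
import HarnessLib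

/-!
# Ring 2 · sub-cell AbelianAll (ALL ABELIAN VARIETIES), André axis, part XXIII-a — HODGE–RIEMANN ON THE TOTAL SPACE:
# the Lefschetz form `(u, v) ↦ Lˢ u ∪ v` of the hyperplane class is NON-DEGENERATE on every sub-Hodge structure of the
# PRIMITIVE cohomology; Hodge types and conjugation pass through the fibre Gysin map `j_{t*}` of a compact abelian pencil

HONEST FRAMING (page 1, verbatim): **research route, not a corollary; conditional on HC_CM plus one named
minimal statement.** Cell line: research route conditional on HC_CM; not a corollary; Q11.4-sentence-2
already refuted in dim ≥ 3. Nothing in this file proves a case of the Hodge conjecture for an abelian variety; `HC_CM`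
(`Theses.RankFourFaces.CMAbelianHodge`) does not occur in this file; item `Theses.RankFourFaces.CMToAbelian` (stmt-16267) OPEN
and not closed here. Seat `pub-hodge-ring2-ab-andre-2`, gen 15; brief (ii) "replace B by algebraicity of specific Lefschetz
components" and (iii) "attack B_min … partial results as theorems". This part is the Hodge-theoretic ENGINE of part XXIII
(XXIII-b: injectivity of the operator `pr_P ∘ j_t^* ∘ (L_K^{m+1})⁻¹ ∘ j_{t*} ∘ L_κᵐ` on the primitive invariant classes;
XXIII-c: the primitive lift (Prim)_t(r) from the SINGLE clause `A_r(𝒳, K)` of Grothendieck's standard conjecture `A` for the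
total space).

## What is proved (theorems only; no definition, no named fact, no sorry)

§1 **`eq_zero_of_forall_cupProduct_eq_zero_of_subHodge_primitive`** — for `X` smooth projective of dimension `n` with a
Kähler–rational datum `D` (`η = D.Hη` the rational Kähler class) and a Hodge model `A`: if `U ⊆ Hᵏ(X(ℂ); ℂ)`, `k + s = n`, is a
`ℂ`-subspace of `η`-PRIMITIVE classes stable under the diagonal type projectors `T^δ = Σ_{p-q=δ} π_{(p,q)}` of `A` and under
complex conjugation, then `u ∈ U` and `Lˢu ∪ v = 0` for all `v ∈ U` force `u = 0`. (Voisin I Thm. 6.32 on `X(ℂ)`, the tree's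
`KaehlerRationalDatum.hodgeRiemann_X`: a non-zero type component `x = π_{(p,q)}u ∈ U` has `Lˢx ∪ x̄ ≠ 0`, while the cross terms
`Lˢ π_{(p',q')}u ∪ x̄` are classes of type `≠ (n,n)` in `H^{2n}`.)
§2 `typeProjDiff_apply_eq_zero_of_mem`, **`map_typeProjDiff_of_mapsTo`** (a linear map sending each type piece into a type
piece with the same `p - q` commutes with the `T^δ`), `lefschetzOperator_mem_typePiece_of_isOfHodgeType`,
`typeProjDiff_lefschetzPowTo_of_isOfHodgeType`, `conjClass_lefschetzPowTo_of_conjClass_eq`, `typeProjDiff_map_comm`.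
§3 On a compact pencil `f : 𝒳 ⟶ S` of abelian `d`-folds (`j_t : X_t ↪ 𝒳`, `j_{t*} = fiberGysin`): `fiberGysin_cupProduct_map_fiberι_of_eq`
(projection formula `j_{t*}(j_t^*a ∪ b) = a ∪ j_{t*}b` in all degrees), `lefschetzOperator_fiberGysin` / **`lefschetzPowTo_fiberGysin`**
(`L_Kⁱ ∘ j_{t*} = j_{t*} ∘ L_κⁱ`, `κ = j_t^*K`), **`conjClass_fiberGysin`** (`j_{t*}` is real: it preserves rational classes, which
span), **`typeProjDiff_fiberGysin`** (`j_{t*}` raises Hodge types by `(1,1)`: the tree's `isOfHodgeType_complexGysin`).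

References: VoisinHodgeI2002 (§6.1.3 Cor. 6.12, §6.2.3 Cor. 6.26 and Rem. 6.27, §6.3.2 Thm. 6.32, §7.1.1–7.1.2, §7.3.2);
VoisinHodgeII2003 (§4.3.1 Thm. 4.18); FultonYoungTableaux1997 (App. B §B.1 (5)–(6)); HatcherAT2002 (§3.2 Prop. 3.10, §3.3).
-/

noncomputable section

set_option linter.dupNamespace false

namespace Summit.HodgeConjecture.HodgeConjecture.Ring2.AbelianAll

open CategoryTheory AlgebraicGeometry
open Literature.AlgebraicGeometry Literature.AlgebraicGeometry.Motives
open Literature.AlgebraicGeometry.HodgeTheory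
open Literature.AlgebraicTopology.SingularHomology (singularCohomology cupProduct cupProduct_map)
open Literature.Geometry.Kaehler (lefschetzOperator lefschetzPow HasHardLefschetzProperty)

/-! ## §1 Hodge–Riemann: the Lefschetz form is non-degenerate on every sub-Hodge structure of the primitive cohomology -/

section HodgeRiemann

variable {n : ℕ} {X : SchemeOver ℂ}

/-- **Non-degeneracy of the Lefschetz form `(u, v) ↦ Lˢu ∪ v` on a sub-Hodge structure of the primitive cohomology.**
Let `X` be smooth projective of dimension `n`, `D` a Kähler–rational datum (rational Kähler class `η = D.Hη`), `A` a Hodge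
model, `k + s = n`, and `U ⊆ Hᵏ(X(ℂ); ℂ)` a `ℂ`-subspace of `η`-PRIMITIVE classes (`L^{s+1} u = 0`) stable under the diagonal
Hodge-type projectors of `A` and under complex conjugation. If `u ∈ U` and `Lˢ u ∪ v = 0` for all `v ∈ U`, then `u = 0`.
Proof: a non-zero type component `x = π_{(p,q)} u ∈ U` has `Lˢ x ∪ x̄ ≠ 0` (Hodge–Riemann, Voisin I Thm. 6.32, the tree's
`KaehlerRationalDatum.hodgeRiemann_X`), while `Lˢ u ∪ x̄ = Σ_{(p',q')} Lˢ π_{(p',q')}u ∪ x̄ = Lˢ x ∪ x̄` — the cross terms are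
classes of type `(p'+s+q, q'+s+p) ≠ (n, n)` in `H^{2n}` and vanish. [cite: VoisinHodgeI2002, §6.3.2 Thm. 6.32 and §7.1.2] -/
theorem eq_zero_of_forall_cupProduct_eq_zero_of_subHodge_primitive (hX : IsSmoothProjective n X)
    (D : KaehlerRationalDatum n X) (A : HodgeModel n X) {k s m₁ : ℕ} (hks : k + s = n) (hm₁ : k + 2 * s = m₁)
    (h2 : m₁ + k = 2 * n) {m₂ : ℕ} (hm₂ : k + 2 * (s + 1) = m₂) {U : Submodule ℂ (complexBetti X k)}
    (hUprim : ∀ u ∈ U, lefschetzPowTo D.Hη (s + 1) k m₂ hm₂ u = 0)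
    (hUtype : ∀ (δ : ℤ), ∀ u ∈ U, A.typeProjDiff k δ u ∈ U)
    (hUconj : ∀ u ∈ U, conjClass (ComplexPoints X) k u ∈ U) {u : complexBetti X k} (hu : u ∈ U)
    (horth : ∀ v ∈ U, cupProduct h2 (lefschetzPowTo D.Hη s k m₁ hm₁ u) v = 0) : u = 0 := by
  classical
  subst hm₁ hm₂
  by_contra hu0
  -- a non-zero type component `x = π_{pq} u`
  obtain ⟨pq, hpq⟩ : ∃ pq, A.typeProj k pq u ≠ 0 := by
    by_contra hall
    push Not at hall
    exact hu0 (by rw [← A.sum_typeProj k u]; exact Finset.sum_eq_zero fun pq _ ↦ hall pq)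
  have hpqk : pq.1.1 + pq.1.2 = k := Finset.HasAntidiagonal.mem_antidiagonal.1 pq.2
  set x := A.typeProj k pq u with hxdef
  have hxU : x ∈ U := by
    rw [hxdef, ← A.typeProjDiff_eq_typeProj pq rfl u]
    exact hUtype _ u hu
  have hxT : x ∈ A.typePiece k pq := A.typeProj_mem k pq u
  have hxprim : lefschetzPow D.Hη (s + 1) k x = 0 := hUprim x hxU
  -- Hodge–Riemann: `Lˢ x ∪ x̄ ≠ 0`
  obtain ⟨t, ht, heq⟩ := D.hodgeRiemann_X hX (s := pq.1.1) (t' := pq.1.2) hks h2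
    (A.isOfHodgeType_of_mem_typePiece hxT) hpq hxprim
  have hne : cupProduct h2 (lefschetzPow D.Hη s k x) (conjClass _ k x) ≠ 0 := by
    intro h0
    rw [h0, smul_zero] at heq
    have ht0 : (t : ℂ) ≠ 0 := by exact_mod_cast ht.ne'
    exact (smul_ne_zero ht0 (D.topClass_ne_zero hX)) heq.symm
  -- `Lˢ u ∪ x̄ = 0` and `= Lˢ x ∪ x̄`
  have h0 := horth _ (hUconj x hxU)
  rw [lefschetzPowTo_eq_lefschetzPow] at h0
  have hsum : cupProduct h2 (lefschetzPow D.Hη s k u) (conjClass _ k x) =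
      ∑ pq', cupProduct h2 (lefschetzPow D.Hη s k (A.typeProj k pq' u)) (conjClass _ k x) := by
    conv_lhs => rw [← A.sum_typeProj k u]
    rw [map_sum, map_sum, LinearMap.sum_apply]
  rw [hsum, Finset.sum_eq_single pq (fun pq' _ hne' ↦ ?_) (fun h ↦ absurd (Finset.mem_univ pq) h)] at h0
  · exact hne h0
  -- cross terms: type `(p' + s + q, q' + s + p)` with one index `> n`
  have hpqk' : pq'.1.1 + pq'.1.2 = k := Finset.HasAntidiagonal.mem_antidiagonal.1 pq'.2
  have hup := isOfHodgeType_lefschetzOperator_of_cupPreservesHodgeType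
    (cupPreservesHodgeType_of_hodgeModel hX D.B) D.isOfHodgeType_Hη
  have hT : IsOfHodgeType n X (2 * n) (pq'.1.1 + s + pq.1.2) (pq'.1.2 + s + pq.1.1)
      (cupProduct h2 (lefschetzPow D.Hη s k (A.typeProj k pq' u)) (conjClass _ k x)) :=
    cupPreservesHodgeType_of_hodgeModel hX D.B h2
      (isOfHodgeType_lefschetzPow_of_lefschetzOperator hup s k pq'.1.1 pq'.1.2 _
        (A.isOfHodgeType_of_mem_typePiece (A.typeProj_mem k pq' u)))
      ((A.isOfHodgeType_of_mem_typePiece hxT).conjClass hX)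
  have hmem := A.mem_typePiece_of_isOfHodgeType hodgePQ_independent_of_hodgeModel_holds hX
    (Finset.HasAntidiagonal.mem_antidiagonal.2
      (by omega : (pq'.1.1 + s + pq.1.2) + (pq'.1.2 + s + pq.1.1) = 2 * n)) hT
  have hp_ne : pq'.1.1 ≠ pq.1.1 := by
    intro h
    exact hne' (Subtype.ext (Prod.ext h (by omega)))
  rcases Nat.lt_or_gt_of_ne hp_ne with hlt | hgt
  · rwa [A.typePiece_eq_bot_of_lt_snd _ (by simp only; omega), Submodule.mem_bot] at hmem
  · rwa [A.typePiece_eq_bot_of_lt_fst _ (by simp only; omega), Submodule.mem_bot] at hmem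

end HodgeRiemann

/-! ## §2 Hodge-type bookkeeping: diagonal type projectors and conjugation through cup products, Gysin maps, pencils -/

section TypeProjectors

variable {m n : ℕ} {Y X : SchemeOver ℂ}

/-- On a class of pure type `(p, q)` with `p - q ≠ δ` the diagonal projector `T^δ` vanishes. [folklore] -/
theorem typeProjDiff_apply_eq_zero_of_mem (A : HodgeModel n X) {k : ℕ} {δ : ℤ}
    {pq : ↥(Finset.HasAntidiagonal.antidiagonal k)} (hpq : (pq.1.1 : ℤ) - pq.1.2 ≠ δ) {c : complexBetti X k}
    (hc : c ∈ A.typePiece k pq) : A.typeProjDiff k δ c = 0 := by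
  classical
  by_cases hex : ∃ pq' : ↥(Finset.HasAntidiagonal.antidiagonal k), (pq'.1.1 : ℤ) - pq'.1.2 = δ
  · obtain ⟨pq', hpq'⟩ := hex
    rw [A.typeProjDiff_eq_typeProj pq' hpq' c]
    exact A.typeProj_apply_of_mem_ne (fun h ↦ hpq (by rw [h, hpq'])) hc
  · push Not at hex
    rw [A.typeProjDiff_eq_zero hex, LinearMap.zero_apply]

/-- **A linear map sending each type piece `(p, q)` into a type piece `σ(p, q)` with the same `p - q` commutes with the
diagonal type projectors**: `T^δ (G c) = G (T^δ c)` (uniqueness of the Hodge decomposition; e.g. `G` a pull-back, a Gysin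
map, or a cup product with a class of type `(c, c)`). [cite: VoisinHodgeI2002, §7.1.1 and §7.3.2] -/
theorem map_typeProjDiff_of_mapsTo (B : HodgeModel m Y) (A : HodgeModel n X) {k l : ℕ}
    (G : complexBetti Y k →ₗ[ℂ] complexBetti X l)
    (σ : ↥(Finset.HasAntidiagonal.antidiagonal k) → ↥(Finset.HasAntidiagonal.antidiagonal l))
    (hσ : ∀ pq, ((σ pq).1.1 : ℤ) - (σ pq).1.2 = (pq.1.1 : ℤ) - pq.1.2)
    (hG : ∀ pq (c : complexBetti Y k), c ∈ B.typePiece k pq → G c ∈ A.typePiece l (σ pq)) (δ : ℤ)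
    (c : complexBetti Y k) : A.typeProjDiff l δ (G c) = G (B.typeProjDiff k δ c) := by
  classical
  have hR : B.typeProjDiff k δ c = ∑ pq, if (pq.1.1 : ℤ) - pq.1.2 = δ then B.typeProj k pq c else 0 := by
    rw [HodgeModel.typeProjDiff, LinearMap.sum_apply]
    refine Finset.sum_congr rfl fun pq _ ↦ ?_
    split_ifs <;> rfl
  conv_lhs => rw [← B.sum_typeProj k c]
  rw [map_sum, map_sum, hR, map_sum]
  refine Finset.sum_congr rfl fun pq _ ↦ ?_
  have hmem : G (B.typeProj k pq c) ∈ A.typePiece l (σ pq) := hG pq _ (B.typeProj_mem k pq c)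
  split_ifs with h
  · rw [← h, ← hσ pq]
    exact A.typeProjDiff_apply_of_mem hmem
  · rw [map_zero]
    exact typeProjDiff_apply_eq_zero_of_mem A (by rw [hσ pq]; exact h) hmem

/-- `L_η` raises `A`-types by `(1,1)` for every class `η` of Hodge type `(1,1)` (cup product preserves Hodge types).
[cite: VoisinHodgeI2002, §6.2.3 Rem. 6.27 and §7.1.2] -/
theorem lefschetzOperator_mem_typePiece_of_isOfHodgeType (hX : IsSmoothProjective n X) (A : HodgeModel n X)
    {η : complexBetti X 2} (hη : IsOfHodgeType n X 2 1 1 η) :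
    ∀ (k l : ℕ) (hkl : 2 + k = l) (pq : ↥(Finset.HasAntidiagonal.antidiagonal k)) (c : complexBetti X k),
      c ∈ A.typePiece k pq → lefschetzOperator η hkl c ∈ A.typePiece l (HodgeModel.typeShift hkl pq) := by
  intro k l hkl pq c hc
  have h := isOfHodgeType_lefschetzOperator_of_cupPreservesHodgeType (cupPreservesHodgeType_of_hodgeModel hX A) hη k l
    hkl pq.1.1 pq.1.2 c (A.isOfHodgeType_of_mem_typePiece hc)
  exact A.mem_typePiece_of_isOfHodgeType hodgePQ_independent_of_hodgeModel_holds hX _ h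

/-- The diagonal projectors commute with the iterated Lefschetz operator of a class of type `(1,1)`. [cite: VoisinHodgeI2002, §6.2.3 Rem. 6.27] -/
theorem typeProjDiff_lefschetzPowTo_of_isOfHodgeType (hX : IsSmoothProjective n X) (A : HodgeModel n X)
    {η : complexBetti X 2} (hη : IsOfHodgeType n X 2 1 1 η) (δ : ℤ) (i k l : ℕ) (h : k + 2 * i = l)
    (c : complexBetti X k) : A.typeProjDiff l δ (lefschetzPowTo η i k l h c) = lefschetzPowTo η i k l h (A.typeProjDiff k δ c) := by
  have hc := map_lefschetzPowTo_of_commute (κ := η) (fun a ↦ (A.typeProjDiff a δ).toAddMonoidHom)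
    (fun k' l' hkl x ↦ A.lefschetzOperator_typeProjDiff (lefschetzOperator_mem_typePiece_of_isOfHodgeType hX A hη) hkl δ x)
    i k l h c
  simpa only [LinearMap.toAddMonoidHom_coe] using hc

/-- Conjugation commutes with the iterated Lefschetz operator of a real class. [cite: VoisinHodgeI2002, Cor. 6.12] -/
theorem conjClass_lefschetzPowTo_of_conjClass_eq {η : complexBetti X 2} (hη : conjClass (ComplexPoints X) 2 η = η)
    (i k l : ℕ) (h : k + 2 * i = l) (c : complexBetti X k) :
    conjClass (ComplexPoints X) l (lefschetzPowTo η i k l h c) = lefschetzPowTo η i k l h (conjClass (ComplexPoints X) k c) := by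
  have hc := map_lefschetzPowTo_of_commute (κ := η) (conjClassHom (ComplexPoints X)) (conjClass_lefschetzOperator hη) i k l h c
  simpa only [conjClassHom_apply] using hc

/-- The diagonal type projectors commute with pull-backs along morphisms of smooth projective varieties (part XVI-a's
`typeProj_map_comm`, summed). [cite: VoisinHodgeI2002, §7.3.2] -/
theorem typeProjDiff_map_comm (hX : IsSmoothProjective n X) (hY : IsSmoothProjective m Y) (g : Y ⟶ X)
    (A : HodgeModel n X) (B : HodgeModel m Y) (k : ℕ) (δ : ℤ) (c : complexBetti X k) :
    B.typeProjDiff k δ (complexBetti.map g k c) = complexBetti.map g k (A.typeProjDiff k δ c) := by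
  classical
  rw [HodgeModel.typeProjDiff, HodgeModel.typeProjDiff, LinearMap.sum_apply, LinearMap.sum_apply, map_sum]
  refine Finset.sum_congr rfl fun pq _ ↦ ?_
  split_ifs
  · exact typeProj_map_comm hX hY g A B k pq c
  · rw [LinearMap.zero_apply, LinearMap.zero_apply, map_zero]

end TypeProjectors

/-! ## §3 The pencil toolkit: projection formula in all degrees, `L_K ∘ j_* = j_* ∘ L_κ`, conjugation and Hodge types through `j_*` -/

section Pencil

variable {𝒳 S : SchemeOver ℂ} {d : ℕ} {f : 𝒳 ⟶ S}

/-- **Projection formula `j_{t*}(j_t^* a ∪ b) = a ∪ j_{t*} b` in all degrees** (`a ∈ H²ᵖ(𝒳)`, `b ∈ H^{2q}(𝒳_t)`, `p + q = c`;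
part XVIII-a had `c = d`). [cite: FultonYoungTableaux1997, Appendix B §B.1 (6)] -/
theorem fiberGysin_cupProduct_map_fiberι_of_eq (hf : IsCompactAbelianPencil f d) (t : ComplexPoints S) {p q c : ℕ}
    (hc : p + q = c) (a : complexBetti 𝒳 (2 * p)) (b : complexBetti (fiberOver f t) (2 * q)) :
    fiberGysin hf t c (cupProduct (show 2 * p + 2 * q = 2 * c by omega) (complexBetti.map (fiberι f t) (2 * p) a) b) =
      cupProduct (show 2 * p + 2 * (q + 1) = 2 * (c + 1) by omega) a (fiberGysin hf t q b) := by
  have h := complexGysin_cup (μ := complexOrientationFamily) hasPoincareDuality_complexOrientationFamily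
    (hf.isSmoothProjective_fiberOver t) hf.isSmoothProjective_total (fiberι f t)
    (show 2 * p + 2 * q = 2 * c by omega) (show 2 * c + 2 * (d + 1) = 2 * (c + 1) + 2 * d by omega)
    (show 2 * q + 2 * (d + 1) = 2 * (q + 1) + 2 * d by omega) (show 2 * p + 2 * (q + 1) = 2 * (c + 1) by omega) a b
  exact h

/-- **`L_K (j_{t*} b) = j_{t*}(L_κ b)`** (`κ = j_t^* K`): the projection formula with `a = K`. [cite: FultonYoungTableaux1997, Appendix B §B.1 (6)] -/
theorem lefschetzOperator_fiberGysin (hf : IsCompactAbelianPencil f d) (t : ComplexPoints S) (K : complexBetti 𝒳 2) {q : ℕ}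
    (b : complexBetti (fiberOver f t) (2 * q)) :
    lefschetzOperator K (show 2 + 2 * (q + 1) = 2 * (q + 1 + 1) by omega) (fiberGysin hf t q b) =
      fiberGysin hf t (q + 1) (lefschetzOperator (complexBetti.map (fiberι f t) 2 K) (show 2 + 2 * q = 2 * (q + 1) by omega) b) := by
  have h := complexGysin_cup (μ := complexOrientationFamily) hasPoincareDuality_complexOrientationFamily
    (hf.isSmoothProjective_fiberOver t) hf.isSmoothProjective_total (fiberι f t)
    (show 2 + 2 * q = 2 * (q + 1) by omega) (show 2 * (q + 1) + 2 * (d + 1) = 2 * (q + 1 + 1) + 2 * d by omega)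
    (show 2 * q + 2 * (d + 1) = 2 * (q + 1) + 2 * d by omega) (show 2 + 2 * (q + 1) = 2 * (q + 1 + 1) by omega) K b
  rw [Literature.Geometry.Kaehler.lefschetzOperator_apply, Literature.Geometry.Kaehler.lefschetzOperator_apply]
  exact h.symm

/-- **`L_Kⁱ ∘ j_{t*} = j_{t*} ∘ L_κⁱ`** (iterate). [cite: FultonYoungTableaux1997, Appendix B §B.1 (6)] -/
theorem lefschetzPowTo_fiberGysin (hf : IsCompactAbelianPencil f d) (t : ComplexPoints S) (K : complexBetti 𝒳 2) (i : ℕ) :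
    ∀ {q c : ℕ} (hc : q + i = c) (b : complexBetti (fiberOver f t) (2 * q)),
      lefschetzPowTo K i (2 * (q + 1)) (2 * (c + 1)) (by omega) (fiberGysin hf t q b) =
        fiberGysin hf t c (lefschetzPowTo (complexBetti.map (fiberι f t) 2 K) i (2 * q) (2 * c) (by omega) b) := by
  induction i with
  | zero =>
    intro q c hc b
    obtain rfl : c = q := by omega
    rw [lefschetzPowTo_zero_eq_id, lefschetzPowTo_zero_eq_id, LinearMap.id_apply, LinearMap.id_apply]
  | succ i ih =>
    intro q c hc b
    obtain ⟨c', rfl⟩ : ∃ c', c = c' + 1 := ⟨q + i, by omega⟩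
    rw [lefschetzPowTo_succ_apply K i (2 * (q + 1)) (2 * (c' + 1)) (2 * (c' + 1 + 1)) (by omega) (by omega) (by omega),
      ih (by omega) b, lefschetzOperator_fiberGysin hf t K,
      ← lefschetzPowTo_succ_apply _ i (2 * q) (2 * c') (2 * (c' + 1)) (by omega) (by omega) (by omega)]

/-- **`j_{t*}` commutes with complex conjugation** (it preserves rational classes — the tree's
`isRationalClass_complexGysin_complexOrientationFamily` — and the rational classes span). [cite: VoisinHodgeI2002, §7.3.2 and Cor. 6.12] -/
theorem conjClass_fiberGysin (hf : IsCompactAbelianPencil f d) (t : ComplexPoints S) (q : ℕ)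
    (b : complexBetti (fiberOver f t) (2 * q)) :
    conjClass (ComplexPoints 𝒳) (2 * (q + 1)) (fiberGysin hf t q b) =
      fiberGysin hf t q (conjClass (ComplexPoints (fiberOver f t)) (2 * q) b) := by
  have hXt := hf.isSmoothProjective_fiberOver t
  have hb : b ∈ Submodule.span ℂ {c : complexBetti (fiberOver f t) (2 * q) | IsRationalClass c} := by
    rw [span_isRationalClass_eq_top_of_isSmoothProjective_holds d (fiberOver f t) hXt (2 * q)]; trivial
  induction hb using Submodule.span_induction with
  | mem c hc =>
    have hr : IsRationalClass (fiberGysin hf t q c) :=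
      isRationalClass_complexGysin_complexOrientationFamily hXt hf.isSmoothProjective_total (fiberι f t) _ hc
    rw [hc.conjClass_eq, hr.conjClass_eq]
  | zero => rw [conjClass_zero, map_zero, conjClass_zero]
  | add x y _ _ hx hy => rw [map_add, conjClass_add (fiberGysin hf t q x), hx, hy, conjClass_add x y, map_add]
  | smul a x _ hx => rw [map_smul, conjClass_smul a (fiberGysin hf t q x), hx, conjClass_smul a x, map_smul]

/-- **`j_{t*}` raises Hodge types by `(1,1)`**: the diagonal type projectors pass through `j_{t*}` (the tree's
`isOfHodgeType_complexGysin`). [cite: VoisinHodgeI2002, §7.3.2] -/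
theorem typeProjDiff_fiberGysin (hf : IsCompactAbelianPencil f d) (t : ComplexPoints S) (A : HodgeModel (d + 1) 𝒳)
    (B : HodgeModel d (fiberOver f t)) (q : ℕ) (δ : ℤ) (b : complexBetti (fiberOver f t) (2 * q)) :
    A.typeProjDiff (2 * (q + 1)) δ (fiberGysin hf t q b) = fiberGysin hf t q (B.typeProjDiff (2 * q) δ b) := by
  have hXt := hf.isSmoothProjective_fiberOver t
  refine map_typeProjDiff_of_mapsTo B A (fiberGysin hf t q)
    (fun pq ↦ ⟨(pq.1.1 + 1, pq.1.2 + 1), Finset.HasAntidiagonal.mem_antidiagonal.2 (by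
      have := Finset.HasAntidiagonal.mem_antidiagonal.1 pq.2; omega)⟩)
    (fun pq ↦ by push_cast; ring) (fun pq c hc ↦ ?_) δ b
  have h : IsOfHodgeType (d + 1) 𝒳 (2 * (q + 1)) (pq.1.1 + 1) (pq.1.2 + 1) (fiberGysin hf t q c) :=
    isOfHodgeType_complexGysin hodgePQ_independent_of_hodgeModel_holds (fun _ _ ↦ nonempty_hodgeModel_holds)
      (fun E _ _ _ ↦ Literature.NumberTheory.Transcendental.exists_deRhamIsoFamily_holds E) complexOrientationFamily hXt
      hf.isSmoothProjective_total (fiberι f t) _ (by omega) (by omega) (B.isOfHodgeType_of_mem_typePiece hc)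
  exact A.mem_typePiece_of_isOfHodgeType hodgePQ_independent_of_hodgeModel_holds hf.isSmoothProjective_total _ h

end Pencil

end Summit.HodgeConjecture.HodgeConjecture.Ring2.AbelianAll

end
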